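import Summits.QuantumFields.YangMills.Theorems.BalabanUVNodesN15TwoGridHolderSteps
import HarnessLib

/-!
# N15 (NE2) — Bałaban's full propagator pair, part 66: MULTI-STEP (1.111) FOR THE TENSOR CLAUSE — the `j`-step oscillation `ρ(s_κ^j − 1)∘G∘ρ(n(s_ν⁻¹ − 1))` («G∇*»)

WHO / WHEN.  Cell `pub-ymgap`, seat `pub-ymgap-dag-n15-a` (KNIT-BY-NAME, g13); `--supports stmt-QuantumFields-20507 --as helper` (count-neutral); `HOME/pub-ymgap-dag-n15-a/DOOR-IV-PLAN.md` §7
(entry 2).  Twin of part 56 (`hasMaj_holderSteps_of_ineq`, the VECTOR clause «∇G») for the TENSOR clause «G∇*» of (1.111).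
WHAT.  (§96) `h1L_ten_eq`: the dictionary `h1L (ten J_ν[μ]) α ζ = ‖ζ·G∇_ν^*μ‖_α` (`holderV` of the embedded real field), `J_ν[μ]` the one-slot tensor source.
(§97) `abs_divSteps_le_of_ineq`: `|(G∇_ν^*μ)(x + je_κ, ι) − (G∇_ν^*μ)(x, ι)| ≤ C_α(α)·e^{−δ₀|nearOf x − y′|}·(‖ζ‖_α + |ζ|)·|μ|·(j∕n)^α` (`1 ≤ j`, `4j ≤ n`).
(§98) ★ `hasMaj_divSteps_of_ineq`: `HasMaj (ofBlocks) (ofBlocks) (ρ(s_κ^j − 1)∘G∘ρ(n(s_ν⁻¹−1))) (|C_α|(Lθ+1)e^{δ₀}·(j∕n)^α·e^{−δ₀|y−y′|_T})` (`4j ≤ n`); (§99) ★ `hasMaj_divSteps_pair`: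
both members of the η-pair of record, one constant pair (from part 42's `ineq110_114_pair`).  Uses: the one-step case (`j = 1`) feeds the sharp-prolongation transfers of parts 44/45/57
(`hasMaj_shiftPull_sub`, `hasMaj_qvRe_pull_sub_comp`, `hasMaj_sA_pull_sub`) applied to `G∇*`, and the multi-step case is the oscillation term of the `L² → sup` interpolation of entry 2.
HONEST FRAMING ∕ LIMITS.  `U ≡ 1` (flat) torus family only; count-neutral (typed 28∕28 · discharged 5∕27 of record unchanged); NOT a discharge of N15 (`NE2PlusOperator`, object-bound);
not ℝ⁴ ∕ OS ∕ mass gap ∕ Clay.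
-/

open scoped BigOperators Matrix
open Finset

namespace Summit.QuantumFields.YangMills.BalabanUVNodes.N15.TwoGrid

open Literature.MathematicalPhysics.QuantumFieldTheory.Balaban1983to89
open Literature.MathematicalPhysics.QuantumFieldTheory.Balaban1983to89.B11SectG (BlockNorm HasMaj hasMaj_zero)
open Literature.MathematicalPhysics.QuantumFieldTheory.Balaban1983to89.B11AxialTransport190 (abs_le_loc_ofBlocks loc_ofBlocks_le)
open Literature.MathematicalPhysics.QuantumFieldTheory.Balaban1983to89.B5Prop11Plancherel (Tor fine unitVec)
open Literature.MathematicalPhysics.QuantumFieldTheory.Balaban1983to89.B5Prop11Lattice (divT)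
open Literature.MathematicalPhysics.QuantumFieldTheory.Balaban1983to89.B5DeltaA169 (DeltaA)
open Literature.MathematicalPhysics.QuantumFieldTheory.Balaban1983to89.B5RealFields (cplx)
open Literature.MathematicalPhysics.QuantumFieldTheory.Balaban1983to89.B5Prop12FieldsLattice (cdistF distSite distU suppInL supNormL h1L holderV cutHL smulV
  distU_nonneg supNormL_nonneg cutHL_nonneg)
open Literature.MathematicalPhysics.QuantumFieldTheory.Balaban1983to89.B5SettingP12Real (LocR VecR latticeSettingP12R)
open Literature.MathematicalPhysics.QuantumFieldTheory.Balaban1983to89.B5SiteBridgeP12 (MP distU_eq_distSite_div)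
open Literature.MathematicalPhysics.QuantumFieldTheory.Balaban1983to89.B5CoverP12Lattice (cutP nearOf Lθ Lθ_nonneg cutP_nearOf_eq_one cutP_nearOf_eq_one_of_distU_le
  cutInL_cutP)
open Literature.MathematicalPhysics.QuantumFieldTheory.Balaban1983to89.B5GlobCoverP12Lattice (cutH_le)
open Literature.MathematicalPhysics.QuantumFieldTheory.Balaban1983to89.B5SupHolderTorus (abs_sub_le_holderV_mul)
open Literature.MathematicalPhysics.QuantumFieldTheory.Balaban1983to89.B5RowSumsP12Lattice (distSite_triangle)
open Literature.MathematicalPhysics.QuantumFieldTheory.Balaban1983to89.LatticeNorms (holderSeminorm_nonneg)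
open Literature.MathematicalPhysics.QuantumFieldTheory.King1986.Torus (blockOf tdistT tdistT_nonneg tdistT_symm)
open Literature.MathematicalPhysics.QuantumFieldTheory.Balaban1983to89.B6UnitTorusCarrier (unitTorusGeo)
open Summit.QuantumFields.YangMills.BalabanUVNodes.N15.VectorPiece (blkFine)

variable {d : ℕ}

/-! ## §96 Dictionary: the tensor Hölder entry of (1.111) at a one-slot source is the Hölder seminorm of `ζ·G∇_ν^*μ` -/

section Steps

variable (M : Fin (d + 1) → ℕ) [∀ μ, NeZero (M μ)] (n : ℕ) [NeZero n] (a : ℝ)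

/-- the divergence of the embedded one-slot tensor source `J_ν[μ]` is the embedded `ρ(n(s_ν⁻¹ − 1))μ`. [cite: Balaban1984PropagatorsI, (1.21) p.21] -/
theorem divT_oneSlot_ofReal (ν : Fin (d + 1)) (μ : Tor (fine n M) × Fin (d + 1) → ℝ) :
    divT n M (fun s b' => (((if s = ν then μ else 0) b' : ℝ) : ℂ)) = fun i => ((symbOp M n ((n : ℝ) • (sTinv M n ν - 1)) μ i : ℝ) : ℂ) := by
  rw [divT, Finset.sum_eq_single ν (fun s _ hs => by
      rw [show (fun b' => (((if s = ν then μ else 0) b' : ℝ) : ℂ)) = 0 from funext fun b' => by simp [hs], Matrix.mulVec_zero])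
    (fun h => absurd (Finset.mem_univ ν) h)]
  funext i
  rw [show (fun b' => (((if ν = ν then μ else 0) b' : ℝ) : ℂ)) = fun b' => ((μ b' : ℝ) : ℂ) from funext fun b' => by simp, star_fdiff_mulVec_ofReal]

/-- **DICTIONARY FOR THE TENSOR CLAUSE OF (1.111)**: `h1L (ten J_ν[μ]) α ζ = ‖ζ·(G∇_ν^*μ)‖_α` (b05's vector Hölder seminorm `holderV` of the embedded real field
`ζ·G∘ρ(n(s_ν⁻¹ − 1))μ`). [cite: Balaban1984PropagatorsI, Prop. 1.2 (1.111) p.35] -/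
theorem h1L_ten_eq (α : ℝ) (ζ : Tor (fine n M) → ℝ) (ν : Fin (d + 1)) (μ : Tor (fine n M) × Fin (d + 1) → ℝ) :
    h1L n M a (LocR.ten fun ν' => if ν' = ν then μ else 0).emb α ζ
      = holderV n M α (cplx fun b => ζ b.1 * gOp M n a (symbOp M n ((n : ℝ) • (sTinv M n ν - 1)) μ) b) := by
  show holderV n M α (smulV n M ζ ((DeltaA n M a)⁻¹ *ᵥ divT n M (fun s b' => (((if s = ν then μ else 0) b' : ℝ) : ℂ)))) = _
  rw [divT_oneSlot_ofReal, inv_mulVec_ofReal_eq]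
  congr 1
  funext b
  simp only [smulV, cplx, Complex.ofReal_mul]

/-! ## §97 The `j`-step difference of `G∇_ν^*μ` through the tensor HÖLDER ENTRY (1.111) -/

/-- ★ **`j` FINE STEPS COST `(j∕n)^α` ON `G∇*`, BY (1.111)** (tensor clause), `1 ≤ j`, `4j ≤ n`, `M_κ ≥ 2`: with `ζ = cutP (nearOf x)`,
`|(G∇_ν^*μ)(x + je_κ, ι) − (G∇_ν^*μ)(x, ι)| ≤ ‖ζ·G∇_ν^*μ‖_α·(j∕n)^α ≤ C_α(α)·e^{−δ₀|nearOf x − y′|}·(‖ζ‖_α + |ζ|)·|μ|·(j∕n)^α` for `supp μ ⊂ Δ̃(y′)` — the tensor (1.111) clause of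
`B5.Ineq110_114` at the concrete setting, unpacked (twin of part 56 §65). [cite: Balaban1984PropagatorsI, Prop. 1.2 (1.111) p.35] -/
theorem abs_divSteps_le_of_ineq (hM2 : ∀ μ, 2 ≤ M μ) {j : ℕ} (hj1 : 1 ≤ j) (hj : 4 * j ≤ n) {K : ℕ} {C δ₀ : ℝ} {Cα Cε : ℝ → ℝ} {Cαε : ℝ → ℝ → ℝ}
    (H : B5.Ineq110_114 (latticeSettingP12R n M a K) C Cα Cε Cαε δ₀) {α : ℝ} (hα0 : 0 ≤ α) (hα1 : α < 1)
    (ν : Fin (d + 1)) (μ : Tor (fine n M) × Fin (d + 1) → ℝ) {y' : Tor M} (hμ : suppInL n M (LocR.ten fun ν' => if ν' = ν then μ else 0).emb y')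
    (κ : Fin (d + 1)) (x : Tor (fine n M)) (ι : Fin (d + 1)) :
    |gOp M n a (symbOp M n ((n : ℝ) • (sTinv M n ν - 1)) μ) (x + j • unitVec (fine n M) κ, ι) - gOp M n a (symbOp M n ((n : ℝ) • (sTinv M n ν - 1)) μ) (x, ι)|
      ≤ Cα α * Real.exp (-(δ₀ * distSite M (nearOf M n x) y')) * cutHL n M α (cutP M n (nearOf M n x))
          * supNormL n M (LocR.ten fun ν' => if ν' = ν then μ else 0).emb * ((j : ℝ) / n) ^ α := by
  have hn1 : 1 ≤ n := by omega
  have hn0 : (0 : ℝ) < n := by exact_mod_cast (show 0 < n by omega)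
  set ζ : Tor (fine n M) → ℝ := cutP M n (nearOf M n x) with hζ
  set v : VecR n M := fun b => ζ b.1 * gOp M n a (symbOp M n ((n : ℝ) • (sTinv M n ν - 1)) μ) b with hv
  have h111 : h1L n M a (LocR.ten fun ν' => if ν' = ν then μ else 0).emb α ζ
      ≤ Cα α * Real.exp (-(δ₀ * distSite M (nearOf M n x) y')) * cutHL n M α ζ * supNormL n M (LocR.ten fun ν' => if ν' = ν then μ else 0).emb :=
    H.2.1 α (LocR.ten fun ν' => if ν' = ν then μ else 0) ζ (nearOf M n x) y' hα0 hα1 (cutInL_cutP M n hn1 _) hμ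
  rw [h1L_ten_eq] at h111
  have hdj : distU n M x (x + j • unitVec (fine n M) κ) ≤ (j : ℝ) / n := distU_add_smul_le M n x κ j
  have hj4 : (j : ℝ) / n ≤ 1 / 4 := by
    rw [div_le_div_iff₀ hn0 (by norm_num : (0 : ℝ) < 4), one_mul]
    exact_mod_cast (show j * 4 ≤ n by omega)
  have hpos : 0 < distU n M x (x + j • unitVec (fine n M) κ) := distU_add_smul_pos M n hM2 x κ hj1 (by omega)
  have hpair := abs_sub_le_holderV_mul α v ι (hdj.trans (hj4.trans (by norm_num))) hpos
  have hζ0 : ζ x = 1 := cutP_nearOf_eq_one M n hn1 x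
  have hζ1 : ζ (x + j • unitVec (fine n M) κ) = 1 := cutP_nearOf_eq_one_of_distU_le M n hn1 (hdj.trans hj4)
  have hv0 : v (x, ι) = gOp M n a (symbOp M n ((n : ℝ) • (sTinv M n ν - 1)) μ) (x, ι) := by simp only [hv, hζ0, one_mul]
  have hv1 : v (x + j • unitVec (fine n M) κ, ι) = gOp M n a (symbOp M n ((n : ℝ) • (sTinv M n ν - 1)) μ) (x + j • unitVec (fine n M) κ, ι) := by
    simp only [hv, hζ1, one_mul]
  rw [← hv0, ← hv1]
  have hhol0 : 0 ≤ holderV n M α (cplx v) := by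
    unfold holderV LatticeNorms.holderSeminormB5
    exact holderSeminorm_nonneg _ _ _ _ _ _
  refine hpair.trans (mul_le_mul h111 ?_ (Real.rpow_nonneg (distU_nonneg _ _) _) (hhol0.trans h111))
  exact Real.rpow_le_rpow (distU_nonneg _ _) hdj hα0

/-! ## §98 The block majorant of `ρ(s_κ^j − 1)∘G∘ρ(n(s_ν⁻¹ − 1))`: `|C_α|(Lθ+1)e^{δ₀}·(j∕n)^α·e^{−δ₀|y−y′|_T}` -/

/-- ★★ **THE `j`-STEP OSCILLATION `ρ(s_κ^j − 1)∘G∘ρ(n(s_ν⁻¹−1))` OF «G∇*» HAS THE BLOCK MAJORANT `C′·(j∕n)^α·e^{−δ₀|y−y′|_T}`**, `C′ = |C_α(α)|·(Lθ+1)·e^{δ₀}`, for every setting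
satisfying `B5.Ineq110_114` (tensor (1.111) clause), `4j ≤ n`, tori with `≥ 2` unit cubes per direction — the derivative sits on the ROUGH (block-localised, sup-normed) source, and still
`j` lattice steps of the output cost only `(j∕n)^α`: this is what no sup-only estimate of «G∇*» gives and what the sharp-prolongation transfers of entry 2 consume.  `j = 0` is the zero
operator. [cite: Balaban1984PropagatorsI, Prop. 1.2 (1.111) p.35] -/
theorem hasMaj_divSteps_of_ineq {L k : ℕ} (hM2 : ∀ μ, 2 ≤ M μ) {j : ℕ} (hj : 4 * j ≤ n) {K : ℕ} {C δ₀ : ℝ} {Cα Cε : ℝ → ℝ} {Cαε : ℝ → ℝ → ℝ}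
    (H : B5.Ineq110_114 (latticeSettingP12R n M a K) C Cα Cε Cαε δ₀) (hδ₀ : 0 ≤ δ₀) {α : ℝ} (hα0 : 0 ≤ α) (hα1 : α < 1)
    (κ ν : Fin (d + 1)) :
    HasMaj (BlockNorm.ofBlocks (unitTorusGeo L k M) (fun i : Tor (fine n M) × Fin (d + 1) => blockOf n M i.1))
      (BlockNorm.ofBlocks (unitTorusGeo L k M) (fun i : Tor (fine n M) × Fin (d + 1) => blockOf n M i.1))
      (symbOp M n (sT M n κ ^ j - 1) ∘ₗ gOp M n a ∘ₗ symbOp M n ((n : ℝ) • (sTinv M n ν - 1)))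
      (fun y y' => |Cα α| * (Lθ (d + 1) + 1) * Real.exp δ₀ * ((j : ℝ) / n) ^ α * Real.exp (-(δ₀ * tdistT M y y'))) := by
  have hn0 : (0 : ℝ) < n := by exact_mod_cast Nat.pos_of_ne_zero (NeZero.ne n)
  have hjn0 : 0 ≤ (j : ℝ) / n := div_nonneg (Nat.cast_nonneg j) hn0.le
  have hK0 : ∀ y y' : Tor M, 0 ≤ |Cα α| * (Lθ (d + 1) + 1) * Real.exp δ₀ * ((j : ℝ) / n) ^ α * Real.exp (-(δ₀ * tdistT M y y')) := fun y y' =>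
    mul_nonneg (mul_nonneg (mul_nonneg (mul_nonneg (abs_nonneg _) (by linarith [Lθ_nonneg (d + 1)])) (Real.exp_nonneg _))
      (Real.rpow_nonneg hjn0 _)) (Real.exp_nonneg _)
  by_cases hj0 : j = 0
  · subst hj0
    have hz : symbOp M n (sT M n κ ^ 0 - 1) ∘ₗ gOp M n a ∘ₗ symbOp M n ((n : ℝ) • (sTinv M n ν - 1)) = 0 := by
      rw [pow_zero, sub_self, map_zero, LinearMap.zero_comp]
    rw [hz]
    exact (hasMaj_zero _ _).mono fun y y' => hK0 y y'
  have hj1 : 1 ≤ j := Nat.one_le_iff_ne_zero.mpr hj0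
  have hn1 : 1 ≤ n := by omega
  intro y' μ hμ y
  set b₁ := BlockNorm.ofBlocks (unitTorusGeo L k M) (fun i : Tor (fine n M) × Fin (d + 1) => blockOf n M i.1) with hb₁
  have hsupp : suppInL n M (LocR.ten fun ν' => if ν' = ν then μ else 0).emb y' := suppInL_ten_of_isLoc M k n hn1 ν hμ
  have hsrc : supNormL n M (LocR.ten fun ν' => if ν' = ν then μ else 0).emb ≤ b₁.loc y' μ := supNormL_ten_le_loc M k n ν hμ
  refine loc_ofBlocks_le (g := unitTorusGeo L k M) (fun i : Tor (fine n M) × Fin (d + 1) => blockOf n M i.1) _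
    (mul_nonneg (hK0 y y') (b₁.loc_nonneg y' μ)) fun b hb => ?_
  obtain ⟨x, ι⟩ := b
  rw [LinearMap.comp_apply, LinearMap.comp_apply, symbOp_sT_pow_sub_one_apply]
  have hstep := abs_divSteps_le_of_ineq M n a hM2 hj1 hj H hα0 hα1 ν μ hsupp κ x ι
  have hnear : tdistT M (nearOf M n x) (blockOf n M x) ≤ 1 := tdistT_nearOf_blockOf_le M n hn1 x
  have hexp : Real.exp (-(δ₀ * distSite M (nearOf M n x) y')) ≤ Real.exp δ₀ * Real.exp (-(δ₀ * tdistT M y y')) := by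
    have htri := distSite_triangle M y (nearOf M n x) y'
    simp only [distSite_eq_tdistT] at htri ⊢
    have hyn : tdistT M y (nearOf M n x) ≤ 1 := by
      rw [tdistT_symm, ← (show blockOf n M x = y from hb)]; exact hnear
    rw [← Real.exp_add, Real.exp_le_exp]
    have h1 : δ₀ * tdistT M y y' ≤ δ₀ * tdistT M y (nearOf M n x) + δ₀ * tdistT M (nearOf M n x) y' := by
      rw [← mul_add]; exact mul_le_mul_of_nonneg_left htri hδ₀
    have h2 : δ₀ * tdistT M y (nearOf M n x) ≤ δ₀ := mul_le_of_le_one_right hδ₀ hyn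
    linarith
  have hcut : cutHL n M α (cutP M n (nearOf M n x)) ≤ Lθ (d + 1) + 1 := cutH_le M n hM2 α _ hα1
  have hE := Real.exp_nonneg (-(δ₀ * distSite M (nearOf M n x) y'))
  have hH := cutHL_nonneg (n := n) (M := M) α (cutP M n (nearOf M n x))
  have hS := supNormL_nonneg (n := n) (M := M) (LocR.ten fun ν' => if ν' = ν then μ else 0).emb
  have hA := abs_nonneg (Cα α)
  have hE1 : 0 ≤ Real.exp δ₀ * Real.exp (-(δ₀ * tdistT M y y')) := by positivity
  have hL1 : 0 ≤ Lθ (d + 1) + 1 := by linarith [Lθ_nonneg (d + 1)]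
  calc |gOp M n a (symbOp M n ((n : ℝ) • (sTinv M n ν - 1)) μ) (x + j • unitVec (fine n M) κ, ι) - gOp M n a (symbOp M n ((n : ℝ) • (sTinv M n ν - 1)) μ) (x, ι)|
      ≤ Cα α * Real.exp (-(δ₀ * distSite M (nearOf M n x) y')) * cutHL n M α (cutP M n (nearOf M n x))
          * supNormL n M (LocR.ten fun ν' => if ν' = ν then μ else 0).emb * ((j : ℝ) / n) ^ α := hstep
    _ ≤ |Cα α| * (Real.exp δ₀ * Real.exp (-(δ₀ * tdistT M y y'))) * (Lθ (d + 1) + 1) * b₁.loc y' μ * ((j : ℝ) / n) ^ α := by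
        refine mul_le_mul_of_nonneg_right ?_ (Real.rpow_nonneg hjn0 _)
        calc Cα α * Real.exp (-(δ₀ * distSite M (nearOf M n x) y')) * cutHL n M α (cutP M n (nearOf M n x))
              * supNormL n M (LocR.ten fun ν' => if ν' = ν then μ else 0).emb
            ≤ |Cα α| * Real.exp (-(δ₀ * distSite M (nearOf M n x) y')) * cutHL n M α (cutP M n (nearOf M n x))
              * supNormL n M (LocR.ten fun ν' => if ν' = ν then μ else 0).emb := by
              gcongr; exact le_abs_self _
          _ ≤ |Cα α| * (Real.exp δ₀ * Real.exp (-(δ₀ * tdistT M y y'))) * (Lθ (d + 1) + 1) * b₁.loc y' μ :=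
              mul_le_mul (mul_le_mul (mul_le_mul_of_nonneg_left hexp hA) hcut hH (mul_nonneg hA hE1)) hsrc hS (mul_nonneg (mul_nonneg hA hE1) hL1)
    _ = |Cα α| * (Lθ (d + 1) + 1) * Real.exp δ₀ * ((j : ℝ) / n) ^ α * Real.exp (-(δ₀ * tdistT M y y')) * b₁.loc y' μ := by ring

end Steps

/-! ## §99 THE η-PAIR OF RECORD: `j`-step oscillation majorants of «G∇*» (coarse, `n = L^k`) and «G′∇′*» (fine, `n′ = L^m·L^k`), one constant pair -/

section Pair

/-- ★ **MULTI-STEP TENSOR (1.111) ON BOTH MEMBERS OF THE η-PAIR OF RECORD**: for odd `L > 1`, `a > 0`, `0 ≤ α < 1` there are `δ₀, C > 0` such that for every torus exponent `m_T`,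
every `k ≥ 1`, every refinement exponent `m`, all directions `κ, ν` and every step count `j`: (coarse) if `4j ≤ L^k` then `ρ(s_κ^j − 1)∘G∘ρ(L^k(s_ν⁻¹−1))` has the block majorant
`C·(j∕L^k)^α·e^{−δ₀|y−y′|_T}`; (fine) if `4j ≤ L^m·L^k` then `ρ′(s_κ^j − 1)∘G′∘ρ′(L^mL^k(s_ν⁻¹−1))` has `C·(j∕(L^m·L^k))^α·e^{−δ₀|y−y′|_T}`.  From `ineq110_114_pair` (part 42)
through §98. [cite: Balaban1984PropagatorsI, Prop. 1.2 (1.111) p.35] -/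
theorem hasMaj_divSteps_pair {L : ℕ} [NeZero L] (hL : Odd L ∧ 1 < L) {a : ℝ} (ha : 0 < a) {α : ℝ} (hα0 : 0 ≤ α) (hα1 : α < 1) :
    ∃ δ₀ C : ℝ, 0 < δ₀ ∧ 0 < C ∧ ∀ (mT k m : ℕ) (hk : 1 ≤ k) (κ ν : Fin (d + 1)) (j : ℕ),
      (4 * j ≤ L ^ k →
        HasMaj (BlockNorm.ofBlocks (unitTorusGeo L k (MP (paramsOf d L mT k hL))) (blkFine L k (MP (paramsOf d L mT k hL))))
          (BlockNorm.ofBlocks (unitTorusGeo L k (MP (paramsOf d L mT k hL))) (blkFine L k (MP (paramsOf d L mT k hL))))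
          (symbOp (MP (paramsOf d L mT k hL)) (L ^ k) (sT (MP (paramsOf d L mT k hL)) (L ^ k) κ ^ j - 1) ∘ₗ
            gOp (MP (paramsOf d L mT k hL)) (L ^ k) a ∘ₗ
              symbOp (MP (paramsOf d L mT k hL)) (L ^ k) (((L ^ k : ℕ) : ℝ) • (sTinv (MP (paramsOf d L mT k hL)) (L ^ k) ν - 1)))
          (fun y y' => C * ((j : ℝ) / ((L ^ k : ℕ) : ℝ)) ^ α * Real.exp (-(δ₀ * tdistT (MP (paramsOf d L mT k hL)) y y')))) ∧
      (4 * j ≤ L ^ m * L ^ k →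
        HasMaj (BlockNorm.ofBlocks (unitTorusGeo L k (MP (paramsOf d L mT k hL)))
            (fun i : Tor (fine (L ^ m * L ^ k) (MP (paramsOf d L mT k hL))) × Fin (d + 1) => blockOf (L ^ m * L ^ k) (MP (paramsOf d L mT k hL)) i.1))
          (BlockNorm.ofBlocks (unitTorusGeo L k (MP (paramsOf d L mT k hL)))
            (fun i : Tor (fine (L ^ m * L ^ k) (MP (paramsOf d L mT k hL))) × Fin (d + 1) => blockOf (L ^ m * L ^ k) (MP (paramsOf d L mT k hL)) i.1))
          (symbOp (MP (paramsOf d L mT k hL)) (L ^ m * L ^ k) (sT (MP (paramsOf d L mT k hL)) (L ^ m * L ^ k) κ ^ j - 1) ∘ₗ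
            gOp (MP (paramsOf d L mT k hL)) (L ^ m * L ^ k) a ∘ₗ
              symbOp (MP (paramsOf d L mT k hL)) (L ^ m * L ^ k)
                (((L ^ m * L ^ k : ℕ) : ℝ) • (sTinv (MP (paramsOf d L mT k hL)) (L ^ m * L ^ k) ν - 1)))
          (fun y y' => C * ((j : ℝ) / ((L ^ m * L ^ k : ℕ) : ℝ)) ^ α * Real.exp (-(δ₀ * tdistT (MP (paramsOf d L mT k hL)) y y')))) := by
  obtain ⟨δ₀, C₀, Cα, Cε, Cαε, hδ₀, _hC₀, HP⟩ := ineq110_114_pair (d := d) hL ha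
  refine ⟨δ₀, |Cα α| * (Lθ (d + 1) + 1) * Real.exp δ₀ + 1, hδ₀, ?_, fun mT k m hk κ ν j => ?_⟩
  · have : 0 ≤ |Cα α| * (Lθ (d + 1) + 1) * Real.exp δ₀ :=
      mul_nonneg (mul_nonneg (abs_nonneg _) (by linarith [Lθ_nonneg (d + 1)])) (Real.exp_nonneg _)
    linarith
  set M : Fin (d + 1) → ℕ := MP (paramsOf d L mT k hL) with hM
  have hL0 : 0 < L := Nat.pos_of_ne_zero (NeZero.ne L)
  have hM2 : ∀ μ, 2 ≤ M μ := fun μ => Nat.le_mul_of_pos_right 2 (pow_pos hL0 mT)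
  have hmono : ∀ (t : ℝ) (ht : 0 ≤ t) (y y' : Tor M),
      |Cα α| * (Lθ (d + 1) + 1) * Real.exp δ₀ * t ^ α * Real.exp (-(δ₀ * tdistT M y y'))
        ≤ (|Cα α| * (Lθ (d + 1) + 1) * Real.exp δ₀ + 1) * t ^ α * Real.exp (-(δ₀ * tdistT M y y')) := fun t ht y y' =>
    mul_le_mul_of_nonneg_right (mul_le_mul_of_nonneg_right (by linarith) (Real.rpow_nonneg ht _)) (Real.exp_nonneg _)
  refine ⟨fun hj => ?_, fun hj => ?_⟩
  · have h := hasMaj_divSteps_of_ineq (L := L) (k := k) M (L ^ k) a hM2 hj (HP mT k m hk).1 hδ₀.le hα0 hα1 κ ν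
    exact h.mono fun y y' => hmono _ (div_nonneg (Nat.cast_nonneg j) (Nat.cast_nonneg _)) y y'
  · have h := hasMaj_divSteps_of_ineq (L := L) (k := k) M (L ^ m * L ^ k) a hM2 hj (HP mT k m hk).2 hδ₀.le hα0 hα1 κ ν
    exact h.mono fun y y' => hmono _ (div_nonneg (Nat.cast_nonneg j) (Nat.cast_nonneg _)) y y'

end Pair

end Summit.QuantumFields.YangMills.BalabanUVNodes.N15.TwoGrid
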